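import Summits.BirchSwinnertonDyer.BirchSwinnertonDyer.Theorems.ManinLocalTwoThreeCongruentTwistNonVacuity
import Literature.NumberTheory.EllipticCurves.FullTwoTorsionConductorExponentProofs
import Literature.NumberTheory.DiophantineGeometry.DenesEquationFreyCurveTwoProofs
import Literature.NumberTheory.EllipticCurves.CongruentNumberCurveAdditiveReduction
import Literature.NumberTheory.EllipticCurves.CuspFormLFunctionLevelConductorProofs
import Literature.NumberTheory.EllipticCurves.BSDAnalyticRankTunnellCMProofs
import Literature.NumberTheory.Automorphic.BCDTModularityTwistInvarianceProofs
import HarnessLib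

/-!
# `N(E_n) = 32 n²` WITHOUT modularity, and `BCDT.IsModular (E_n)` for every odd squarefree `n` — fact-free
(route `ManinLocalTwoThree`, crux C3 `ManinPrimeToThreeAtNine` stmt-BirchSwinnertonDyer-22968 / C2 stmt-…-22967; cell bsd-f2-manin, prover seat p2
gen 24; `--supports stmt-BirchSwinnertonDyer-22968`; companion of `…CongruentTwistNonVacuity` (p768674))

The tree had the conductor of the congruent number curve `E_n : y² = x³ − n²x` (`n` odd squarefree) only MODULO MODULARITY
(`conductorNorm_congruentNumberCurve_of_odd (hmod : exists_isNewformOf)`, read off the CM functional equation through the level lemma, which needs a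
functional equation at level `N_E`).  With the newform of `E_n` at level `32n²` now in the tree (`NonVacuity.exists_isNewformOf_congruentNumberCurve_of_odd`,
p768674) the conductor follows from three PROVED local facts and no printed fact:

* `2`-part: `E_n` is the translate `x ↦ x + n` of the Frey-shape curve `y² = x(x − n)(x − 2n)` (`congruentNumberCurve_eq_smul_freyCurve`), whose conductor
  exponent at `2` is `5` by the tree's Tate computation `conductorExponent_freyCurve_two_of_two_dvd` (`A = n` odd, `B = −2n`, `2 ∥ B`; Darmon–Merel 1997
  Prop. 1.1 (1), type III), and the conductor is an isomorphism invariant (`conductorNorm_smul_rat`);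
* odd `p ∣ n`: `E_n` is globally minimal with full rational `2`-torsion `{0, ±n}` and additive at `p`
  (`hasAdditiveReductionAt_congruentNumberCurve_of_dvd`), so `ord_p N = 2` (`factorization_conductorNorm_eq_two_of_additive_of_fullTwoTorsion`);
* `p ∤ 2n`: the level `32n²` of the newform and the conductor have the same prime factors (`IsNewformOf.primeFactors_level_eq`, `q`-expansion
  arithmetic), so `ord_p N = 0`.

Hence (§2) **`conductorNorm_congruentNumberCurve_of_odd'` : `N(E_n) = 32n²`, UNCONDITIONAL**, and (§3) **`isModular_congruentNumberCurve_of_odd` :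
`BCDT.IsModular (congruentNumberCurve n)` for every odd squarefree `n`** (the newform sits at the conductor level) — an infinite family of unconditional
instances of BCDT's condition (2), after `Tunnell1983.isModular_congruentNumberCurve_one`; and Carayol's «level = conductor» CHECKS OUT on every
witness of the non-vacuity file (`levelTwoPart_witness_congruent`).  Nothing here bears on C2/C3/Manin/BSD beyond non-vacuity bookkeeping; the items stay
OPEN as filed.  No definitions, no sorry.
[cite: DarmonMerel1997, Prop. 1.1 (1)] [cite: SilvermanATAEC1994, Table 4.1 and Thm. IV.11.1] [cite: KoblitzECMF1993, Ch. II §5, Theorem (p. 84)]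
[cite: AtkinLi1978, §3, Thm. 3.1] [cite: BCDTJAMS2001, Introduction, condition (2)]
-/

set_option autoImplicit false
-- lint-debt: the directory name repeats the summit name (sibling precedent `ManinLocalTwoThreeCongruentTwistNonVacuity.lean`)
set_option linter.dupNamespace false

noncomputable section

open scoped MatrixGroups ModularForm Classical
open CongruenceSubgroup WeierstrassCurve IsDedekindDomain NumberField Rat.HeightOneSpectrum
open Literature.NumberTheory.EllipticCurves Literature.NumberTheory.EllipticCurves.ModularForms
open Literature.NumberTheory.Automorphic Literature.NumberTheory.DiophantineGeometry
open Literature.NumberTheory.EllipticCurves.Greenberg1999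

namespace Summit.BirchSwinnertonDyer.BirchSwinnertonDyer.Theorems.ManinLocalTwoThree.NonVacuity

/-! ## §1 The local inputs -/

/-- **`E_n` is the translate `x ↦ x + n` of the Frey-shape curve `y² = x(x − n)(x − 2n)`** (`freyCurve n (−2n)`, roots `0, n, 2n`; the tree's
`variableChange_freyCurve_trivial` is the case `n = 1`). [folklore] -/
theorem congruentNumberCurve_eq_smul_freyCurve (n : ℕ) :
    congruentNumberCurve n = (⟨1, n, 0, 0⟩ : VariableChange ℚ) • freyCurve (n : ℤ) (-(2 * n)) := by
  ext <;> simp [freyCurve, variableChange_def, congruentNumberCurve] <;> ring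

/-- **Full rational `2`-torsion of `E_n`**: the three points `(0,0)`, `(n,0)`, `(−n,0)` (`n ≠ 0`), in Greenberg's predicate `HasRationalTwoTorsionX`.
[cite: KoblitzECMF1993, Ch. I §2] -/
theorem fullTwoTorsion_congruentNumberCurve {n : ℕ} (hn : n ≠ 0) :
    ∃ x₁ x₂ x₃ : ℚ, x₁ ≠ x₂ ∧ x₁ ≠ x₃ ∧ x₂ ≠ x₃ ∧ HasRationalTwoTorsionX (congruentNumberCurve n) x₁ ∧
      HasRationalTwoTorsionX (congruentNumberCurve n) x₂ ∧ HasRationalTwoTorsionX (congruentNumberCurve n) x₃ := by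
  have hn' : (n : ℚ) ≠ 0 := by exact_mod_cast hn
  refine ⟨0, n, -n, by simpa using hn'.symm, by simpa using hn', ?_, ?_, ?_, ?_⟩
  · intro h
    have : (2 : ℚ) * n = 0 := by linarith
    exact hn' (by simpa using this)
  all_goals
    refine ⟨0, ?_, by simp [congruentNumberCurve]⟩
    rw [WeierstrassCurve.Affine.equation_iff]
    simp [congruentNumberCurve]
    try ring

/-- **`ord₂ N(E_n) = 5` for odd `n`** — Tate's algorithm at `2` on the Frey shape `y² = x(x − n)(x − 2n)` (`A = n` odd, `B = −2n = 2·(−n)`, `−n` odd: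
type III, `f₂ = 5`, the tree's `conductorExponent_freyCurve_two_of_two_dvd`), transported along the translate (`conductorNorm_smul_rat`).  UNCONDITIONAL.
[cite: DarmonMerel1997, Prop. 1.1 (1)] -/
theorem factorization_two_conductorNorm_congruentNumberCurve {n : ℕ} [NeZero n] (hodd : Odd n) :
    ((congruentNumberCurve n).conductorNorm ℤ).factorization 2 = 5 := by
  have hn0 : (n : ℤ) ≠ 0 := by exact_mod_cast NeZero.ne n
  have hABC : (n : ℤ) * (-(2 * n)) * ((n : ℤ) + -(2 * n)) ≠ 0 := by
    have : (n : ℤ) * (-(2 * n)) * ((n : ℤ) + -(2 * n)) = 2 * (n : ℤ) ^ 3 := by ring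
    rw [this]; positivity
  haveI hF : (freyCurve (n : ℤ) (-(2 * n))).IsElliptic := isElliptic_freyCurve hABC
  haveI : (congruentNumberCurve n).IsElliptic := isElliptic_congruentNumberCurve (NeZero.ne n)
  have hoddZ : ¬ (2 : ℤ) ∣ (n : ℤ) := fun h ↦ hodd.not_two_dvd_nat (by exact_mod_cast h)
  rw [congruentNumberCurve_eq_smul_freyCurve, conductorNorm_smul_rat,
    show (2 : ℕ) = ((⟨2, Nat.prime_two⟩ : Nat.Primes) : ℕ) from rfl, factorization_conductorNorm_primesEquiv_symm]
  exact conductorExponent_freyCurve_two_of_two_dvd _ (Literature.NumberTheory.EllipticCurves.Rat.natGenerator_primesEquiv_symm _)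
    hABC hoddZ (b := -(n : ℤ)) (by ring) (by rwa [dvd_neg])

/-- **`ord_p N(E_n) = 2` at every odd prime `p ∣ n`** (`n` squarefree): `E_n` is globally minimal with full rational `2`-torsion and additive at `p`.
UNCONDITIONAL. [cite: SilvermanATAEC1994, Table 4.1 and Thm. IV.11.1] -/
theorem factorization_conductorNorm_congruentNumberCurve_of_dvd {n : ℕ} (hsq : Squarefree n) {p : ℕ} [hp : Fact p.Prime] (hp2 : p ≠ 2)
    (hpn : p ∣ n) : ((congruentNumberCurve n).conductorNorm ℤ).factorization p = 2 := by
  haveI : (congruentNumberCurve n).IsElliptic := isElliptic_congruentNumberCurve hsq.ne_zero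
  haveI : (congruentNumberCurve n).IsGloballyMinimal := isGloballyMinimal_congruentNumberCurve hsq
  set v : HeightOneSpectrum (𝓞 ℚ) := (primesEquiv (R := 𝓞 ℚ)).symm ⟨p, hp.out⟩ with hvdef
  have hv : primesEquiv v = ⟨p, hp.out⟩ := Equiv.apply_symm_apply _ _
  have hgen : natGenerator v = p := congrArg Subtype.val hv
  have hadd : (congruentNumberCurve n).HasAdditiveReductionAt v :=
    hasAdditiveReductionAt_congruentNumberCurve_of_dvd v hsq (by rw [hgen]; exact hp2) (by rw [hgen]; exact hpn)
  obtain ⟨hng, hnm⟩ := not_good_not_mult_of_hasAdditiveReductionAt_ringOfIntegers (congruentNumberCurve n) p hadd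
  exact factorization_conductorNorm_eq_two_of_additive_of_fullTwoTorsion (congruentNumberCurve n) p hp2 hng hnm
    (fullTwoTorsion_congruentNumberCurve hsq.ne_zero)

/-- **`ord_p N(E_n) = 0` at every prime `p ∤ 2n`** (`n` odd squarefree): the newform of `E_n` has level `32n²` (p768674) and the level of a newform has the
same prime factors as the conductor (`IsNewformOf.primeFactors_level_eq`, `q`-expansion arithmetic, unconditional). [cite: DiamondShurman2005, Prop. 5.8.5] -/
theorem factorization_conductorNorm_congruentNumberCurve_of_not_dvd {n : ℕ} [NeZero n] (hodd : Odd n) (hsq : Squarefree n) {p : ℕ}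
    (hp : ¬ p ∣ 2 * n) : ((congruentNumberCurve n).conductorNorm ℤ).factorization p = 0 := by
  haveI : (congruentNumberCurve n).IsElliptic := isElliptic_congruentNumberCurve (NeZero.ne n)
  obtain ⟨F, hF⟩ := exists_isNewformOf_congruentNumberCurve_of_odd hodd hsq
  by_cases hpp : p.Prime
  swap
  · exact Nat.factorization_eq_zero_of_not_prime _ hpp
  refine Nat.factorization_eq_zero_of_not_dvd fun hdvd ↦ hp ?_
  have hmem : p ∈ ((congruentNumberCurve n).conductorNorm ℤ).primeFactors :=
    Nat.mem_primeFactors.mpr ⟨hpp, hdvd, ((congruentNumberCurve n).conductorNorm_pos_holds).ne'⟩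
  rw [← hF.primeFactors_level_eq, Nat.mem_primeFactors] at hmem
  obtain ⟨-, h32, -⟩ := hmem
  -- `p ∣ 32 n² = 2⁵ n² ⟹ p ∣ 2n`
  have h' : p ∣ 2 ^ 5 * n ^ 2 := by simpa using h32
  rcases (Nat.Prime.dvd_mul hpp).mp h' with h | h
  · exact (hpp.dvd_of_dvd_pow h).mul_right n
  · exact (hpp.dvd_of_dvd_pow h).mul_left 2

/-! ## §2 The conductor, unconditionally -/

/-- **`N(E_n) = 32 n²` for every odd squarefree `n`, UNCONDITIONALLY** (the tree's `conductorNorm_congruentNumberCurve_of_odd` minus its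
`exists_isNewformOf` hypothesis): prime by prime from §1 (`2 ↦ 5`, `p ∣ n ↦ 2`, `p ∤ 2n ↦ 0`) and `Nat.eq_of_factorization_eq`.
[cite: KoblitzECMF1993, Ch. II §5, Theorem (p. 84)] [cite: DarmonMerel1997, Prop. 1.1 (1)] -/
theorem conductorNorm_congruentNumberCurve_of_odd' {n : ℕ} (hodd : Odd n) (hsq : Squarefree n) :
    (congruentNumberCurve n).conductorNorm ℤ = 32 * n ^ 2 := by
  haveI : NeZero n := ⟨hsq.ne_zero⟩
  haveI : (congruentNumberCurve n).IsElliptic := isElliptic_congruentNumberCurve hsq.ne_zero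
  refine Nat.eq_of_factorization_eq ((congruentNumberCurve n).conductorNorm_pos_holds).ne'
    (mul_ne_zero (by norm_num) (pow_ne_zero 2 hsq.ne_zero)) fun q ↦ ?_
  have hR : (32 * n ^ 2).factorization q = (if 2 = q then 5 else 0) + 2 * n.factorization q := by
    rw [show (32 : ℕ) = 2 ^ 5 by norm_num, Nat.factorization_mul (by positivity) (pow_ne_zero 2 hsq.ne_zero),
      Finsupp.add_apply, Nat.Prime.factorization_pow Nat.prime_two, Finsupp.single_apply, Nat.factorization_pow,
      Finsupp.smul_apply, smul_eq_mul]
  rw [hR]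
  by_cases hq : q.Prime
  swap
  · rw [Nat.factorization_eq_zero_of_not_prime _ hq, Nat.factorization_eq_zero_of_not_prime _ hq, mul_zero, add_zero,
      if_neg (fun h ↦ hq (by rw [← h]; exact Nat.prime_two))]
  by_cases h2 : q = 2
  · subst h2
    rw [factorization_two_conductorNorm_congruentNumberCurve hodd, if_pos rfl,
      Nat.factorization_eq_zero_of_not_dvd hodd.not_two_dvd_nat]
  rw [if_neg (Ne.symm h2), zero_add]
  haveI : Fact q.Prime := ⟨hq⟩
  by_cases hqn : q ∣ n
  · rw [factorization_conductorNorm_congruentNumberCurve_of_dvd hsq h2 hqn]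
    have h1 : n.factorization q ≤ 1 := hsq.natFactorization_le_one q
    have h1' : 1 ≤ n.factorization q := (Nat.Prime.dvd_iff_one_le_factorization hq hsq.ne_zero).mp hqn
    omega
  · have hq2n : ¬ q ∣ 2 * n := fun h ↦ by
      rcases (Nat.Prime.dvd_mul hq).mp h with h' | h'
      · exact h2 ((Nat.prime_dvd_prime_iff_eq hq Nat.prime_two).mp h')
      · exact hqn h'
    rw [factorization_conductorNorm_congruentNumberCurve_of_not_dvd hodd hsq hq2n, Nat.factorization_eq_zero_of_not_dvd hqn]

/-- **`N(E₃) = 288`** for `E₃ : y² = x³ − 9x`.  UNCONDITIONAL. [cite: KoblitzECMF1993, Ch. II §5, Theorem (p. 84)] -/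
theorem conductorNorm_congruentNumberCurve_three : (congruentNumberCurve 3).conductorNorm ℤ = 288 := by
  rw [conductorNorm_congruentNumberCurve_of_odd' (n := 3) (by decide) Nat.prime_three.prime.squarefree]; norm_num

/-! ## §3 `BCDT.IsModular` for the odd congruent number curves; Carayol on the witnesses -/

/-- **Every odd squarefree congruent number curve is modular in the sense of BCDT (2)** — its newform sits at the conductor level `32n²`
(§2 + p768674's `exists_isNewformOf_congruentNumberCurve_of_odd`).  UNCONDITIONAL; after `Tunnell1983.isModular_congruentNumberCurve_one`, an infinite
family of instances of the tree's modularity predicate. [cite: BCDTJAMS2001, Introduction, condition (2)] [cite: AtkinLi1978, §3, Thm. 3.1] -/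
theorem isModular_congruentNumberCurve_of_odd {n : ℕ} (hodd : Odd n) (hsq : Squarefree n)
    [NeZero ((congruentNumberCurve n).conductorNorm ℤ)] : BCDT.IsModular (congruentNumberCurve n) := by
  haveI : NeZero n := ⟨hsq.ne_zero⟩
  obtain ⟨F, hF⟩ := exists_isNewformOf_congruentNumberCurve_of_odd hodd hsq
  exact BCDT.isModular_of_isNewformOf_of_eq (congruentNumberCurve n) hF (conductorNorm_congruentNumberCurve_of_odd' hodd hsq).symm

/-- `N(E_n) ≠ 0` (the instance under which `BCDT.IsModular E_n` is stated; a theorem, use `haveI`). [folklore] -/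
theorem neZero_conductorNorm_congruentNumberCurve {n : ℕ} (hn : n ≠ 0) : NeZero ((congruentNumberCurve n).conductorNorm ℤ) :=
  haveI := isElliptic_congruentNumberCurve hn
  ⟨((congruentNumberCurve n).conductorNorm_pos_holds).ne'⟩

/-- **`E₃ : y² = x³ − 9x` is modular in the sense of BCDT (2)**, UNCONDITIONALLY. [cite: BCDTJAMS2001, Introduction, condition (2)] -/
theorem isModular_congruentNumberCurve_three :
    @BCDT.IsModular (congruentNumberCurve 3) (neZero_conductorNorm_congruentNumberCurve (n := 3) (by norm_num)) := by
  haveI := neZero_conductorNorm_congruentNumberCurve (n := 3) (by norm_num)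
  exact isModular_congruentNumberCurve_of_odd (n := 3) (by decide) Nat.prime_three.prime.squarefree

/-- **Carayol's «level = conductor» CHECKS OUT on every witness of the non-vacuity file**: the tree's named fact `IsNewformOf.level_eq_conductorNorm` (the
one use of modularity in the rung's cone) holds AT the levels `32n²` for the congruent number curves, by §2 and the tree's unconditional strong
multiplicity one across levels (`IsNewformOf.level_eq_level`). [cite: Carayol1986] [cite: AtkinLehner1970, Thm. 4] -/
theorem level_eq_conductorNorm_congruentNumberCurve {n : ℕ} [NeZero n] (hodd : Odd n) (hsq : Squarefree n) {N : ℕ} [NeZero N]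
    {f : CuspForm (Gamma0 N) 2} (hf : IsNewformOf (congruentNumberCurve n) f) : N = (congruentNumberCurve n).conductorNorm ℤ := by
  haveI : (congruentNumberCurve n).IsElliptic := isElliptic_congruentNumberCurve (NeZero.ne n)
  obtain ⟨F, hF⟩ := exists_isNewformOf_congruentNumberCurve_of_odd hodd hsq
  rw [hf.level_eq_level hF, conductorNorm_congruentNumberCurve_of_odd' hodd hsq]

end Summit.BirchSwinnertonDyer.BirchSwinnertonDyer.Theorems.ManinLocalTwoThree.NonVacuity

end
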